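/-
Copyright: statement-level skeleton of a published paper (lit-balaban cell, Phase-2 proof seat p25, gen 21). No proof
claims beyond what the kernel checks below.
-/
import Literature.MathematicalPhysics.QuantumFieldTheory.BalabanImbrieJaffe1984to88.BIJ88WalkIneq312CovSplit
import Literature.MathematicalPhysics.QuantumFieldTheory.BalabanImbrieJaffe1984to88.BIJ88WalkProductCutoffVolFree312

/-!
# `BalabanImbrieJaffe1984to88.BIJ88WalkIneq312CovSplitVolFree` — T. Bałaban, J. Imbrie, A. Jaffe, *Effective action and
cluster properties of the abelian Higgs model*, Commun. Math. Phys. **114** (1988) 257–315 [BalabanImbrieJaffe1988],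
§5.14 pp. 310, 312 [PDF 54, 56] (x2 renders `lit-balaban-r16/renders/cmp114/original-p054-x2.png`, `…-p056-x2.png`),
verbatim: *"The leading terms, with only propagators C^{(k)}_{Λ₁₂^{(k)},loc}, C^{(k)}_{Λ₁₂^{(k)},loc}(u_{k+1}), we
transform further. The others, localized in region X, have a factor of e^{−cr(e_k)|X|}. We also
consider as remainders any terms whose order in λ and e is greater than n̄."* and *"(We allow adjustments in β, α, β′,
keeping them small.)"* (p. 310) and the estimate preceding (5.14.5) (p. 312); §5.2
p. 278 (5.2.1)–(5.2.4) (product cutoffs, as quoted in `BIJ88WalkProductCutoffVolFree312`).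

**THE VOLUME-FREE PRODUCT-CUTOFF MEMBER ON THE COVARIANCE PIECES OF RECORD** (p25 gen 21; file N5 of the member-level
currency generalization of row C2.Claim@312, owner r16 ruling 2026-08-23T11:27:10Z; the head of record
`BIJ88WalkIneq312RemainderBdry.ineq312_remainder_bdry` UNCHANGED).  Gen 20 instantiated the head's clause C1 on the
model's two covariance pieces `covSplit blk Δ W R` (`BIJ88WalkIneq312CovSplit`: `B′_p = ‖Cov p‖·R_∞·max(R₁,1)`, C1 =
two numbers) and its clause C3 on print's product cutoffs (`BIJ88WalkProductCutoff312`, with the volume factor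
`(#B·a)^{Φ₀}`).  Here both at once, in the volume-free currency `N(z) = Σ_b|z(y_b)|` of site cutoffs
`χ(ψ) = Π_{b∈B} χ₁(ψ(y_b)/p)` (distinct sites `y_b`): `ineq312_remainder_bdry_prodCutoff_N` (gen 21, N4) with
`Cov := covSplit R`, `Dir = {‖u‖_∞ ≤ R_∞ ∧ Σ|u| ≤ R₁}`, bracket letters as in gen 20 PLUS the `ℓ¹→ℓ¹` letter of N4 §5:
`B′_p := ‖Cov p‖·R_∞·max(R₁,1) + C₁(p)·R₁`, `C₁(p)` a bound on the column sums `Σ_x|(Cov p)_{xy}|` — so C1 is again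
TWO NUMBERS (`B′_loc ≤ B_ℓ`, `B′_tail ≤ θ_w`), NONE of which sees `#B`, and `c_F = K_V·a_O^{Φ₀(O)}·Λ_O^{mom}·W_O^{Φ₀(O)}`
with the moment letters DERIVED from the norms (gen 20's `moment_letters_of_norm`).

* §1 **`ineq312_remainder_bdry_prodCutoff_covSplit_N`** — the head's conclusion for `Cov = covSplit R`, site product
  cutoffs, volume-free constant; hypotheses: the two numbers, `hvert`, the locality count `N₀`, `K_V`, (5.2.3), `hbeat`.
* §2 ([folklore] linear algebra) `stepOp_pow_mul_inv_eq` (`T^kD⁻¹ = D⁻¹(ND⁻¹)^k`), `transpose_stepOp_pow_mul_inv`,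
  **`transpose_locPiece`**, **`transpose_tailPiece`** (THE TWO PIECES OF `prec⁻¹` ARE SYMMETRIC for `prec ≻ 0`),
  `colsum_le_norm_of_transpose_eq`, **`colsum_covSplit_le_norm`** (`Σ_x|(Cov p)_{xy}| ≤ ‖Cov p‖`: the `ℓ¹` letter IS
  gen 20's `ℓ^∞` letter), **`ineq312_remainder_bdry_prodCutoff_covSplit_norm`** (§1 with `C₁ := ‖Cov ·‖` discharged:
  the two numbers are `‖C_{loc,R}‖·(R_∞max(R₁,1)+R₁) ≤ B_ℓ`, `‖C_{tail,R}‖·(R_∞max(R₁,1)+R₁) ≤ θ_w`).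
* §2b `sum_abs_coeff_le`, `hBzN_coeff_of_colsum` — the same booking letter for BOND/plaquette cutoffs ((5.2.2)'s
  `χ_b = χ(p(e_k), |(D_{ū_k}φ)(b)|)`): incidence-bounded coefficient functionals are `ℓ¹`-bounded, `Σ_b|ℓ_b z| ≤ m·Σ|z|`.
* §3 **`ineq312_remainder_bdry_prodCutoff_N_toy`** — KERNEL NON-VACUITY of N4's `ineq312_remainder_bdry_prodCutoff_N`
  with a REAL profile: every hypothesis discharged on the one-site toy of `BIJ88WalkIneq312NonVacuity` for any
  `χ₁ : CutoffProfile`, except the profile's own (5.2.3) letter (as gen 20's toy, now with the volume-free constant).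

statement-level skeleton of published theorems with citation tags; proofs where landed; nothing here is a claim
about the Yang–Mills mass gap

PDF held: `paper:balaban1988-cmp114-bij-abelian-higgs-effective-action` (journal page = PDF page + 256); pp. 278, 310,
312 as in the sibling files.

CITATION HEADER (lean-in-tree rule).  lit-balaban cell (HOME `run/shared/lean/pub/lit-balaban/`), Phase 2, seat p25
gen 21; row **C2.Claim@312** of `HOME/lit-balaban-r16/ROWS-C2-part2.md` (owner r16, referee ref-5; head theorem of
record UNCHANGED; this file is a MEMBER).  USED BY NAME, nothing restated:
`BIJ88WalkProductCutoffVolFree312.{ineq312_remainder_bdry_prodCutoff_N, hBzN_site_of_colsum}` (p25 gen 21),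
`BIJ88WalkIneq312CovSplit.{bracket_le_of_mem, moment_letters_of_norm}`, `BIJ88WalkCovarianceSplit310.{covSplit,
blockDiag, offDiag, stepOp, locPiece, tailPiece, isHermitian_blockDiag, locPiece_add_tailPiece_of_posDef}`,
`BIJ88WalkIneq312NonVacuity.toy_prec_posDef` (p25 gen 19–20), r18's `BIJ88Sect5Statements.CutoffProfile`.
HONEST SCOPE: (a) as `BIJ88WalkIneq312CovSplit` (walk-length cut-off `R` ↔ print's `O(r(e_k))`; one tail piece,
`reg ≡ ∅`; the SIZES `‖C_{loc,R}‖`, `‖C_{tail,R}‖` are inputs — print's random-walk decay is not derived; by §2 the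
column-sum letters of the symmetric pieces of record ARE these two norms, so no new letter);
(b) as `BIJ88WalkProductCutoffVolFree312` (`K_V`, the profile's (5.2.3) letter; site cutoffs at distinct sites); (c)
the head's clauses C2 (`c_V`, `θ_v`), C4 (`hbeat`), C5 (`bdry`) verbatim; (H1)–(H5) as in the head.  NOT summit
progress; NOT continuum; NOT Clay.  Imports `BIJ88WalkIneq312CovSplit`, `BIJ88WalkProductCutoffVolFree312`; modifies
nothing; 0 `sorry`, 0 definitions, 0 `Prop` facts.
-/

noncomputable section

namespace Literature.MathematicalPhysics.QuantumFieldTheory.BalabanImbrieJaffe1984to88.BIJ88WalkIneq312CovSplitVolFree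

open Classical MeasureTheory Matrix Finset
open scoped BigOperators Matrix.Norms.Operator ContDiff
open Literature.MathematicalPhysics.QuantumFieldTheory.Balaban1983to89
open B2Eq228Conditioning (weight source)
open BIJ88PolymerRep5134 (corner)
open BIJ88PolymerRep5134Gauss (prec src)
open BIJ88SlotMomentsGauss308 (fieldLaw)
open BIJ88VertexIbp311 (vexp)
open BIJ88WickDerivatives305 (dlist)
open BIJ88VertexComponents311 (maxArity)
open BIJ88WalkRun311 BIJ88WalkExpansion311 BIJ88WalkRemainderActivity312 BIJ88WalkIneq312Remainder
  BIJ88WalkCovarianceSplit310 BIJ88WalkIneq312CovSplit BIJ88WalkProductCutoff312 BIJ88WalkProductCutoffVolFree312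

/-! ## §1  The volume-free product-cutoff member on the two covariance pieces of record -/

section Law
variable {ι : Type} [Fintype ι] {κ : Type} [LinearOrder κ] {β : Type} [DecidableEq β]
variable {α I : Type} [Fintype α] [DecidableEq α] [Fintype I] [DecidableEq I]
  {blk : α → I} {Δ : Matrix α α ℝ} {ℱ : α → ℝ} {W : Finset I}

/-- **THE HEAD THEOREM OF ROW C2.Claim@312 FOR SITE PRODUCT CUTOFFS ON THE COVARIANCE PIECES OF RECORD, VOLUME-FREE**:
`ineq312_remainder_bdry_prodCutoff_N` with `Cov := covSplit blk Δ W R` (`false ↦ C_{loc,R}` non-triggering,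
`true ↦ C_{tail,R}` triggering), `reg ≡ ∅`, `ρ ≡ 1`, `ρ₀ = 2`, `Dir = {u : ‖u‖_∞ ≤ R_∞ ∧ Σ|u| ≤ R₁}`,
`χ(ψ) = Π_{b∈B} χ₁(ψ(y_b)/p)` at distinct sites `y_b`, `B′_p = ‖Cov p‖·R_∞·max(R₁,1) + C₁(p)·R₁` with
`Σ_x|(Cov p)_{xy}| ≤ C₁(p)` (column sums): the bracket clauses `hB`/`hBf` AND the booking clause `hBzN` are PROVED, C1
is the two numbers `B′_loc ≤ B_ℓ`, `B′_tail ≤ θ_w`; the moment letters are derived from `‖prec⁻¹‖`, `‖ℱ|_W‖_∞`, `R_∞`,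
`R₁`; `c_F = K_V·a_O^{Φ₀(O)}·Λ_O^{mom}·(max 1 (2(Φ₀(O)+N₀)))^{Φ₀(O)}` — no `#B` anywhere.
[cite: BalabanImbrieJaffe1988, §5.14 p.312 (estimate preceding (5.14.5)); p.310; (5.2.1)-(5.2.4) p.278] -/
theorem ineq312_remainder_bdry_prodCutoff_covSplit_N (hPD : (prec blk Δ W (corner ℝ W)).PosDef) (R : ℕ)
    {Rinf R1 : ℝ} (hRinf : 0 ≤ Rinf) (hR1 : 0 ≤ R1) {c : ι → ℝ}
    {legs : ι → List ({x : α // blk x ∈ W} → ℝ)} {obs : κ → List ({x : α // blk x ∈ W} → ℝ)} {M : ℕ}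
    {oc : κ → Finset β} {vc : ι → Finset β} {cV : ι → ℝ} {Bl θ θv θw : ℝ} {N₀ : ℕ}
    {B : Type} (Bs : Finset B) {y : B → {x : α // blk x ∈ W}} (hy : Set.InjOn y Bs)
    {g : ℝ → ℝ} (hg : ContDiff ℝ ∞ g) {cg : ℝ}
    (hgc : ∀ (n : ℕ) (x : ℝ), |iteratedDeriv n g x| ≤ cg ^ n * (n : ℝ) ^ (cg * n))
    {KV p : ℝ} (hV : ∀ φ, |vexp c legs φ| ≤ KV) (hp1 : 1 ≤ p)
    {C₁ : Bool → ℝ} (hC0 : ∀ q, 0 ≤ C₁ q) (hC : ∀ q yy, ∑ x, |covSplit blk Δ W R q x yy| ≤ C₁ q)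
    (hθ0 : 0 < θ) (hθ1 : θ ≤ 1) (hBl : 1 ≤ Bl) (hcV0 : ∀ m, 0 ≤ cV m)
    (hθv : 0 < θv) (hθv1 : θv ≤ 1) (hθw : 0 < θw) (hθw1 : θw ≤ 1)
    (hsrc : ∑ x, |src blk ℱ W x| ≤ R1) (hcV : ∀ m, |c m| ≤ cV m)
    (hobs : ∀ j, ∀ w ∈ obs j, ‖w‖ ≤ Rinf ∧ ∑ x, |w x| ≤ R1)
    (hlegs : ∀ m, ∀ w ∈ legs m, ‖w‖ ≤ Rinf ∧ ∑ x, |w x| ≤ R1)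
    (hBl' : ‖covSplit blk Δ W R false‖ * Rinf * max R1 1 + C₁ false * R1 ≤ Bl)
    (hθw' : ‖covSplit blk Δ W R true‖ * Rinf * max R1 1 + C₁ true * R1 ≤ θw)
    (hvert : ∀ m, cV m * Bl ^ (legs m).length ≤ θv * θ ^ (vc m).card)
    (hN : ∀ q, ∀ u : {x : α // blk x ∈ W} → ℝ, ‖u‖ ≤ Rinf ∧ ∑ x, |u x| ≤ R1 →
      (∑ m, ((range (legs m).length).filter fun j =>
        (covSplit blk Δ W R q *ᵥ u) ⬝ᵥ (legs m).getD j 0 ≠ 0).card) ≤ N₀)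
    (bdry : Finset κ)
    (hbeat : ∀ O : Finset κ, ∀ t ∈ expand (covSplit blk Δ W R) (fun q => q) (src blk ℱ W) c legs obs M 0 O,
      t.consts = 0 → ∀ X ∈ t.groups,
      max p⁻¹ (max (θv ^ M) θw) * ∏ j ∈ X.lab.filter (fun j => j ∉ bdry), Bl ^ (obs j).length ≤ 1) :
    BIJ88Sect5StatementsPart4.Ineq312 (remSys κ β)
      (fun OX => remAt (prec blk Δ W (corner ℝ W)) (covSplit blk Δ W R) (fun q => q) (src blk ℱ W) c legs obs M
          (fun ψ => ∏ b ∈ Bs, g (p⁻¹ * (ContinuousLinearMap.proj (y b) : ({x : α // blk x ∈ W} → ℝ) →L[ℝ] ℝ) ψ))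
          oc vc (fun _ => (∅ : Finset β)) [] 0 OX.1 OX.2
        / ∫ φ, weight (prec blk Δ W (corner ℝ W)) φ * source (src blk ℱ W) φ)
      (fun OX => KV * ((max 1 (max 1 cg * (max 1 (phi0 legs obs M OX.1 : ℝ)) ^ cg)) ^ phi0 legs obs M OX.1
            * ∑ N ∈ range (phi0 legs obs M OX.1 + 1),
              2 ^ N * ((‖(prec blk Δ W (corner ℝ W))⁻¹‖ * ‖src blk ℱ W‖ * R1) ^ N
                + (1 + (‖(prec blk Δ W (corner ℝ W))⁻¹‖ * Rinf * R1) ^ N * ((2 * N - 1).doubleFactorial : ℝ))))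
          * (max 1 (2 * ((phi0 legs obs M OX.1 + N₀ : ℕ) : ℝ))) ^ phi0 legs obs M OX.1)
      (fun OX => ∏ j ∈ OX.1.filter (fun j => j ∈ bdry), Bl ^ (obs j).length)
      (fun OX => nfreeOf oc OX.2) θ 1 := by
  set A := prec blk Δ W (corner ℝ W) with hA
  have hmax : 0 < max R1 1 := lt_of_lt_of_le zero_lt_one (le_max_right _ _)
  have hμs : 0 ≤ ‖A⁻¹‖ * ‖src blk ℱ W‖ * R1 := mul_nonneg (mul_nonneg (norm_nonneg _) (norm_nonneg _)) hR1
  have hvs : 0 ≤ ‖A⁻¹‖ * Rinf * R1 := mul_nonneg (mul_nonneg (norm_nonneg _) hRinf) hR1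
  have hBr0 : ∀ q, 0 ≤ ‖covSplit blk Δ W R q‖ * Rinf * max R1 1 := fun q =>
    mul_nonneg (mul_nonneg (norm_nonneg _) hRinf) hmax.le
  have hCr0 : ∀ q, 0 ≤ C₁ q * R1 := fun q => mul_nonneg (hC0 q) hR1
  refine ineq312_remainder_bdry_prodCutoff_N (Dir := {u | ‖u‖ ≤ Rinf ∧ ∑ x, |u x| ≤ R1})
    (B' := fun q => ‖covSplit blk Δ W R q‖ * Rinf * max R1 1 + C₁ q * R1) (ρ := fun _ => 1) (ρ₀ := 2)
    (reg := fun _ => (∅ : Finset β)) (trig := fun q => q)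
    hPD Bs (fun b => ContinuousLinearMap.proj (y b)) hg hgc hV hp1 hμs hvs
    (fun j w hw => moment_letters_of_norm A (src blk ℱ W) (hobs j w hw))
    (fun m w hw => moment_letters_of_norm A (src blk ℱ W) (hlegs m w hw))
    hθ0 hθ1 hBl (fun q => add_nonneg (hBr0 q) (hCr0 q)) (fun _ => zero_le_one) hcV0 hθv hθv1 hθw hθw1
    (fun q u hu w hw => ?_) (fun q u hu => ?_) (fun q u hu => ?_) hcV (fun j w hw => hobs j w hw)
    (fun m w hw => hlegs m w hw) (fun q hq => ?_) (fun q hq => ?_) hvert zero_le_two (fun u _ => ?_)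
    (fun q u hu => hN q u hu) bdry hbeat
  · rw [mul_one]; exact (bracket_le_of_mem _ hRinf hu.1 hw.2).trans (le_add_of_nonneg_right (hCr0 q))
  · rw [mul_one]; exact (bracket_le_of_mem _ hRinf hu.1 hsrc).trans (le_add_of_nonneg_right (hCr0 q))
  · rw [mul_one]
    exact (hBzN_site_of_colsum Bs hy hC0 hC (fun u hu => hu.2) q u hu).trans (le_add_of_nonneg_left (hBr0 q))
  · subst hq; exact ⟨hBl', rfl⟩
  · subst hq; rw [card_empty, pow_zero, mul_one]; exact hθw'
  · calc _ ≤ ∑ _q : Bool, (1 : ℝ) :=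
          Finset.sum_le_sum_of_subset_of_nonneg (filter_subset _ _) fun _ _ _ => zero_le_one
      _ = 2 := by norm_num

end Law
/-! ## §2  For the symmetric pieces of record the `ℓ¹` letter is the `ℓ^∞` letter -/

section SymmAux
variable {n : Type} [Fintype n]

omit [Fintype n] in
/-- a real Hermitian matrix is symmetric (bookkeeping). [folklore] -/
private theorem transpose_eq_of_isHermitian {M : Matrix n n ℝ} (h : M.IsHermitian) : Mᵀ = M := by
  rw [← Matrix.conjTranspose_eq_transpose_of_trivial]; exact h.eq

/-- **column sums of a symmetric matrix are row sums, bounded by the `ℓ^∞`-operator norm**: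
`Σ_x|M_{xy}| ≤ ‖M‖` if `Mᵀ = M`. [folklore] [cite: BalabanImbrieJaffe1988, §5.14 p.310] -/
theorem colsum_le_norm_of_transpose_eq {M : Matrix n n ℝ} (hM : Mᵀ = M) (y : n) : ∑ x, |M x y| ≤ ‖M‖ := by
  have e : ∑ x, |M x y| = ∑ x, |M y x| := Finset.sum_congr rfl fun x _ => by rw [← Matrix.transpose_apply M y x, hM]
  rw [e, Matrix.linfty_opNorm_def]
  have h : (∑ x, ‖M y x‖₊ : NNReal) ≤ Finset.univ.sup fun i => ∑ j, ‖M i j‖₊ :=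
    Finset.le_sup (f := fun i => ∑ j, ‖M i j‖₊) (Finset.mem_univ y)
  have h2 : (∑ x, |M y x|) = ((∑ x, ‖M y x‖₊ : NNReal) : ℝ) := by
    push_cast; exact Finset.sum_congr rfl fun j _ => (Real.norm_eq_abs _).symm
  rw [h2]; exact_mod_cast h

end SymmAux

section Symm
variable {n : Type} [Fintype n] [DecidableEq n] {I' : Type} [DecidableEq I'] (b : n → I') {A : Matrix n n ℝ}

/-- the shift identity `T^k D⁻¹ = D⁻¹ (N D⁻¹)^k` (`T = D⁻¹N`). [folklore] [cite: BalabanImbrieJaffe1988, §5.14 p.310] -/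
theorem stepOp_pow_mul_inv_eq (k : ℕ) :
    stepOp b A ^ k * (blockDiag b A)⁻¹
      = (blockDiag b A)⁻¹ * (BIJ88WalkCovarianceSplit310.offDiag b A * (blockDiag b A)⁻¹) ^ k := by
  induction k with
  | zero => simp
  | succ k ih =>
    have e : stepOp b A ^ (k + 1) = stepOp b A ^ k * ((blockDiag b A)⁻¹ * BIJ88WalkCovarianceSplit310.offDiag b A) := by
      rw [pow_succ]; rfl
    calc stepOp b A ^ (k + 1) * (blockDiag b A)⁻¹
        = (stepOp b A ^ k * (blockDiag b A)⁻¹) * (BIJ88WalkCovarianceSplit310.offDiag b A * (blockDiag b A)⁻¹) := by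
          rw [e]; simp only [Matrix.mul_assoc]
      _ = (blockDiag b A)⁻¹ * ((BIJ88WalkCovarianceSplit310.offDiag b A * (blockDiag b A)⁻¹) ^ k
            * (BIJ88WalkCovarianceSplit310.offDiag b A * (blockDiag b A)⁻¹)) := by rw [ih, Matrix.mul_assoc]
      _ = _ := by rw [← pow_succ]

/-- **THE WALK TERMS ARE SYMMETRIC**: `(T^k D⁻¹)ᵀ = T^k D⁻¹` for symmetric `A` (a palindrome `D⁻¹ N D⁻¹ ⋯ N D⁻¹`).
[folklore] [cite: BalabanImbrieJaffe1988, §5.14 p.310] -/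
theorem transpose_stepOp_pow_mul_inv (hA : A.IsHermitian) (k : ℕ) :
    (stepOp b A ^ k * (blockDiag b A)⁻¹)ᵀ = stepOp b A ^ k * (blockDiag b A)⁻¹ := by
  have hD : (blockDiag b A)ᵀ = blockDiag b A := transpose_eq_of_isHermitian (isHermitian_blockDiag hA)
  have hN : (BIJ88WalkCovarianceSplit310.offDiag b A)ᵀ = BIJ88WalkCovarianceSplit310.offDiag b A := by
    show (blockDiag b A - A)ᵀ = blockDiag b A - A
    rw [Matrix.transpose_sub, hD, transpose_eq_of_isHermitian hA]
  have hDi : ((blockDiag b A)⁻¹)ᵀ = (blockDiag b A)⁻¹ := by rw [Matrix.transpose_nonsing_inv, hD]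
  conv_lhs => rw [stepOp_pow_mul_inv_eq]
  rw [Matrix.transpose_mul, Matrix.transpose_pow, Matrix.transpose_mul, hDi, hN]
  rfl

/-- **THE TWO PIECES ARE SYMMETRIC**: `C_{loc,R}ᵀ = C_{loc,R}` and, for `A ≻ 0`, `C_{tail,R}ᵀ = C_{tail,R}`.
[folklore] [cite: BalabanImbrieJaffe1988, §5.14 p.310] -/
theorem transpose_locPiece (hA : A.IsHermitian) (R : ℕ) : (locPiece b A R)ᵀ = locPiece b A R := by
  show ((∑ k ∈ range R, stepOp b A ^ k) * (blockDiag b A)⁻¹)ᵀ = (∑ k ∈ range R, stepOp b A ^ k) * (blockDiag b A)⁻¹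
  rw [Finset.sum_mul, Matrix.transpose_sum]
  exact Finset.sum_congr rfl fun k _ => transpose_stepOp_pow_mul_inv b hA k

/-- (continued) [folklore] [cite: BalabanImbrieJaffe1988, §5.14 p.310] -/
theorem transpose_tailPiece (hA : A.PosDef) (R : ℕ) : (tailPiece b A R)ᵀ = tailPiece b A R := by
  have h : tailPiece b A R = A⁻¹ - locPiece b A R :=
    eq_sub_of_add_eq' (locPiece_add_tailPiece_of_posDef (b := b) hA R)
  rw [h, Matrix.transpose_sub, transpose_locPiece b hA.isHermitian, Matrix.transpose_nonsing_inv,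
    transpose_eq_of_isHermitian hA.isHermitian]

end Symm
section SymmModel

variable {ι : Type} [Fintype ι] {κ : Type} [LinearOrder κ] {β : Type} [DecidableEq β]
variable {α I : Type} [Fintype α] [DecidableEq α] [Fintype I] [DecidableEq I]
  {blk : α → I} {Δ : Matrix α α ℝ} {ℱ : α → ℝ} {W : Finset I}

/-- **FOR THE PIECES OF RECORD THE COLUMN-SUM LETTER IS `‖Cov p‖`**: `Σ_x|(covSplit R q)_{xy}| ≤ ‖covSplit R q‖`
(`prec ≻ 0` symmetric ⇒ both pieces symmetric) — so §1's `C₁(q)` may be taken `= ‖covSplit R q‖`, the SAME number as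
gen 20's `ℓ^∞` bracket letter: the volume-free member costs no new letter on the model of record.
[cite: BalabanImbrieJaffe1988, §5.14 p.310] -/
theorem colsum_covSplit_le_norm (hPD : (prec blk Δ W (corner ℝ W)).PosDef) (R : ℕ) (q : Bool)
    (y : {x : α // blk x ∈ W}) : ∑ x, |covSplit blk Δ W R q x y| ≤ ‖covSplit blk Δ W R q‖ := by
  letI : DecidableEq {x : α // blk x ∈ W} := fun a b => Classical.propDecidable (a = b)
  refine colsum_le_norm_of_transpose_eq ?_ y
  cases q
  · simp only [covSplit, cond_false]; exact transpose_locPiece _ hPD.isHermitian R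
  · simp only [covSplit, cond_true]; exact transpose_tailPiece _ hPD R

/-- **§1 WITH `C₁ := ‖covSplit R ·‖` DISCHARGED**: the volume-free product-cutoff member on the pieces of record with
the two numbers `‖C_{loc,R}‖·(R_∞·max(R₁,1) + R₁) ≤ B_ℓ`, `‖C_{tail,R}‖·(R_∞·max(R₁,1) + R₁) ≤ θ_w` — the same two
`ℓ^∞`-operator norms as gen 20's `ineq312_remainder_bdry_covSplit`, nothing else.
[cite: BalabanImbrieJaffe1988, §5.14 p.312 (estimate preceding (5.14.5)); p.310; (5.2.1)-(5.2.4) p.278] -/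
theorem ineq312_remainder_bdry_prodCutoff_covSplit_norm (hPD : (prec blk Δ W (corner ℝ W)).PosDef) (R : ℕ)
    {Rinf R1 : ℝ} (hRinf : 0 ≤ Rinf) (hR1 : 0 ≤ R1) {c : ι → ℝ}
    {legs : ι → List ({x : α // blk x ∈ W} → ℝ)} {obs : κ → List ({x : α // blk x ∈ W} → ℝ)} {M : ℕ}
    {oc : κ → Finset β} {vc : ι → Finset β} {cV : ι → ℝ} {Bl θ θv θw : ℝ} {N₀ : ℕ}
    {B : Type} (Bs : Finset B) {y : B → {x : α // blk x ∈ W}} (hy : Set.InjOn y Bs)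
    {g : ℝ → ℝ} (hg : ContDiff ℝ ∞ g) {cg : ℝ}
    (hgc : ∀ (n : ℕ) (x : ℝ), |iteratedDeriv n g x| ≤ cg ^ n * (n : ℝ) ^ (cg * n))
    {KV p : ℝ} (hV : ∀ φ, |vexp c legs φ| ≤ KV) (hp1 : 1 ≤ p)
    (hθ0 : 0 < θ) (hθ1 : θ ≤ 1) (hBl : 1 ≤ Bl) (hcV0 : ∀ m, 0 ≤ cV m)
    (hθv : 0 < θv) (hθv1 : θv ≤ 1) (hθw : 0 < θw) (hθw1 : θw ≤ 1)
    (hsrc : ∑ x, |src blk ℱ W x| ≤ R1) (hcV : ∀ m, |c m| ≤ cV m)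
    (hobs : ∀ j, ∀ w ∈ obs j, ‖w‖ ≤ Rinf ∧ ∑ x, |w x| ≤ R1)
    (hlegs : ∀ m, ∀ w ∈ legs m, ‖w‖ ≤ Rinf ∧ ∑ x, |w x| ≤ R1)
    (hBl' : ‖covSplit blk Δ W R false‖ * (Rinf * max R1 1 + R1) ≤ Bl)
    (hθw' : ‖covSplit blk Δ W R true‖ * (Rinf * max R1 1 + R1) ≤ θw)
    (hvert : ∀ m, cV m * Bl ^ (legs m).length ≤ θv * θ ^ (vc m).card)
    (hN : ∀ q, ∀ u : {x : α // blk x ∈ W} → ℝ, ‖u‖ ≤ Rinf ∧ ∑ x, |u x| ≤ R1 →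
      (∑ m, ((range (legs m).length).filter fun j =>
        (covSplit blk Δ W R q *ᵥ u) ⬝ᵥ (legs m).getD j 0 ≠ 0).card) ≤ N₀)
    (bdry : Finset κ)
    (hbeat : ∀ O : Finset κ, ∀ t ∈ expand (covSplit blk Δ W R) (fun q => q) (src blk ℱ W) c legs obs M 0 O,
      t.consts = 0 → ∀ X ∈ t.groups,
      max p⁻¹ (max (θv ^ M) θw) * ∏ j ∈ X.lab.filter (fun j => j ∉ bdry), Bl ^ (obs j).length ≤ 1) :
    BIJ88Sect5StatementsPart4.Ineq312 (remSys κ β)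
      (fun OX => remAt (prec blk Δ W (corner ℝ W)) (covSplit blk Δ W R) (fun q => q) (src blk ℱ W) c legs obs M
          (fun ψ => ∏ b ∈ Bs, g (p⁻¹ * (ContinuousLinearMap.proj (y b) : ({x : α // blk x ∈ W} → ℝ) →L[ℝ] ℝ) ψ))
          oc vc (fun _ => (∅ : Finset β)) [] 0 OX.1 OX.2
        / ∫ φ, weight (prec blk Δ W (corner ℝ W)) φ * source (src blk ℱ W) φ)
      (fun OX => KV * ((max 1 (max 1 cg * (max 1 (phi0 legs obs M OX.1 : ℝ)) ^ cg)) ^ phi0 legs obs M OX.1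
            * ∑ N ∈ range (phi0 legs obs M OX.1 + 1),
              2 ^ N * ((‖(prec blk Δ W (corner ℝ W))⁻¹‖ * ‖src blk ℱ W‖ * R1) ^ N
                + (1 + (‖(prec blk Δ W (corner ℝ W))⁻¹‖ * Rinf * R1) ^ N * ((2 * N - 1).doubleFactorial : ℝ))))
          * (max 1 (2 * ((phi0 legs obs M OX.1 + N₀ : ℕ) : ℝ))) ^ phi0 legs obs M OX.1)
      (fun OX => ∏ j ∈ OX.1.filter (fun j => j ∈ bdry), Bl ^ (obs j).length)
      (fun OX => nfreeOf oc OX.2) θ 1 :=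
  ineq312_remainder_bdry_prodCutoff_covSplit_N hPD R hRinf hR1 Bs hy hg hgc hV hp1 (C₁ := fun q => ‖covSplit blk Δ W R q‖)
    (fun _ => norm_nonneg _) (fun q yy => colsum_covSplit_le_norm hPD R q yy) hθ0 hθ1 hBl hcV0 hθv hθv1 hθw hθw1
    hsrc hcV hobs hlegs (by simpa only [mul_add, mul_assoc] using hBl') (by simpa only [mul_add, mul_assoc] using hθw')
    hvert hN bdry hbeat

end SymmModel
/-! ## §2b  Bond/plaquette cutoffs: incidence-bounded functionals are `ℓ¹`-bounded too -/

section Incidence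
variable {S : Type} [Fintype S]

/-- **INCIDENCE-BOUNDED FUNCTIONALS** (print's (5.2.2) cutoffs sit on sites `x, y`, on BONDS `b` through
`(D_{ū_k}φ)(b)` and on plaquettes `p` through `u(p)`): for functionals `ℓ_b(z) = Σ_x c_{bx} z_x` whose coefficients
touch each site with total weight `Σ_{b∈B}|c_{bx}| ≤ m` (a bond difference touches its two endpoints with weight
`≤ 1`, so `m = 2d` on `ℤ^d`), `Σ_{b∈B}|ℓ_b(z)| ≤ m·Σ_x|z_x|` — the currency `N` of such a product cutoff is again
`ℓ¹`-bounded, uniformly in `#B`. [folklore] [cite: BalabanImbrieJaffe1988, (5.2.2) p.278] -/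
theorem sum_abs_coeff_le {B : Type} (Bs : Finset B) (c : B → S → ℝ) {m : ℝ} (hc : ∀ x, ∑ b ∈ Bs, |c b x| ≤ m)
    (z : S → ℝ) : ∑ b ∈ Bs, |∑ x, c b x * z x| ≤ m * ∑ x, |z x| := by
  calc ∑ b ∈ Bs, |∑ x, c b x * z x| ≤ ∑ b ∈ Bs, ∑ x, |c b x| * |z x| := Finset.sum_le_sum fun b _ =>
        (Finset.abs_sum_le_sum_abs _ _).trans (le_of_eq (Finset.sum_congr rfl fun x _ => abs_mul _ _))
    _ = ∑ x, |z x| * ∑ b ∈ Bs, |c b x| := by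
        rw [Finset.sum_comm]
        exact Finset.sum_congr rfl fun x _ => by rw [Finset.mul_sum]; exact Finset.sum_congr rfl fun b _ => mul_comm _ _
    _ ≤ ∑ x, |z x| * m := Finset.sum_le_sum fun x _ => mul_le_mul_of_nonneg_left (hc x) (abs_nonneg _)
    _ = m * ∑ x, |z x| := by rw [← Finset.sum_mul, mul_comm]

/-- the coefficient functional `z ↦ Σ_x c_{bx} z_x` as a continuous linear map and its value. [folklore]
[cite: BalabanImbrieJaffe1988, (5.2.2) p.278] -/
theorem coeffCLM_apply (c : S → ℝ) (z : S → ℝ) :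
    (∑ x, c x • (ContinuousLinearMap.proj x : (S → ℝ) →L[ℝ] ℝ)) z = ∑ x, c x * z x := by
  simp only [FunLike.coe_sum, Finset.sum_apply, FunLike.coe_smul, Pi.smul_apply, ContinuousLinearMap.proj_apply,
    smul_eq_mul]

/-- **THE BOOKING INPUT `hBzN` FOR BOND/PLAQUETTE PRODUCT CUTOFFS**: with `ℓ_b = Σ_x c_{bx}·(evaluation at x)`,
incidence weight `≤ m`, column sums `Σ_x|(C_p)_{xy}| ≤ C₁(p)` and `Σ|u| ≤ R₁` on `Dir`:
`Σ_b|ℓ_b(C_p u)| ≤ m·C₁(p)·R₁` — volume-free. [cite: BalabanImbrieJaffe1988, §5.14 p.310; (5.2.2) p.278] -/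
theorem hBzN_coeff_of_colsum {P B : Type} (Bs : Finset B) (c : B → S → ℝ) {m : ℝ} (hm : 0 ≤ m)
    (hc : ∀ x, ∑ b ∈ Bs, |c b x| ≤ m)
    {Cov : P → Matrix S S ℝ} {C₁ : P → ℝ} (hC0 : ∀ p, 0 ≤ C₁ p) (hC : ∀ p yy, ∑ x, |Cov p x yy| ≤ C₁ p)
    {Dir : Set (S → ℝ)} {R₁ : ℝ} (hDir : ∀ u ∈ Dir, ∑ x, |u x| ≤ R₁) :
    ∀ p, ∀ u ∈ Dir,
      (∑ b ∈ Bs, |(∑ x, c b x • (ContinuousLinearMap.proj x : (S → ℝ) →L[ℝ] ℝ)) (Cov p *ᵥ u)|) ≤ m * C₁ p * R₁ := by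
  intro p u hu
  simp only [coeffCLM_apply]
  refine (sum_abs_coeff_le Bs c hc _).trans ?_
  rw [mul_assoc]
  exact mul_le_mul_of_nonneg_left ((sum_abs_mulVec_le (Cov p) (hC p) u).trans
    (mul_le_mul_of_nonneg_left (hDir u hu) (hC0 p))) hm

end Incidence

/-! ## §3  Kernel non-vacuity of the volume-free product-cutoff member with a REAL profile -/
section Toy

open BIJ88Sect5Statements (CutoffProfile)
open BIJ88VertexIbp311 (vpoly)
open BIJ88WalkIneq312NonVacuity (toy_prec_posDef)

/-- **NON-VACUITY OF `ineq312_remainder_bdry_prodCutoff_N` WITH A GENUINE PROFILE**: on the one-site toy of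
`BIJ88WalkIneq312NonVacuity` (one observable with the leg `e = 1`, no vertex, `Cov ≡ 0`, `Dir = univ`,
`B′ = ρ = ρ₀ = N₀ = 0`, `B_ℓ = θ = θ_v = θ_w = 1`, `M = 1`, `bdry = {()}`) with the site cutoff `χ(ψ) = χ₁(ψ(site)/1)`
for ANY `χ₁ : CutoffProfile`, `K_V = p = 1`, `μ_* = 0`, `v_* = max(e·prec⁻¹e, 0)`: every hypothesis of N4 §4 is
discharged by the kernel except the profile's own (5.2.3) letter `hgc`; the constant carries NO `#B`.
[cite: BalabanImbrieJaffe1988, §5.14 p.312 (estimate preceding (5.14.5)); (5.2.3) p.278] -/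
theorem ineq312_remainder_bdry_prodCutoff_N_toy (χp : CutoffProfile) {cg : ℝ}
    (hgc : ∀ (n : ℕ) (x : ℝ), |iteratedDeriv n χp.χ₁ x| ≤ cg ^ n * (n : ℝ) ^ (cg * n)) :
    BIJ88Sect5StatementsPart4.Ineq312 (remSys Unit Unit)
      (fun OX => remAt (prec (fun _ : Unit => ()) (1 : Matrix Unit Unit ℝ) ({()} : Finset Unit) (corner ℝ ({()} : Finset Unit)))
          (fun _ : Unit => (0 : Matrix {x : Unit // (fun _ : Unit => ()) x ∈ ({()} : Finset Unit)}
            {x : Unit // (fun _ : Unit => ()) x ∈ ({()} : Finset Unit)} ℝ)) (fun _ => false)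
          (src (fun _ : Unit => ()) (0 : Unit → ℝ) ({()} : Finset Unit)) (fun _ : Fin 0 => (0 : ℝ)) (fun _ : Fin 0 => [])
          (fun _ : Unit => [fun _ => (1 : ℝ)]) 1
          (fun ψ => ∏ b ∈ (univ : Finset Unit), χp.χ₁ ((1 : ℝ)⁻¹ *
            (fun _ : Unit => (ContinuousLinearMap.proj ⟨(), Finset.mem_singleton_self ()⟩ :
              ({x : Unit // (fun _ : Unit => ()) x ∈ ({()} : Finset Unit)} → ℝ) →L[ℝ] ℝ)) b ψ))
          (fun _ : Unit => (∅ : Finset Unit)) (fun _ : Fin 0 => (∅ : Finset Unit)) (fun _ => (∅ : Finset Unit)) [] 0 OX.1 OX.2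
        / ∫ φ, weight (prec (fun _ : Unit => ()) (1 : Matrix Unit Unit ℝ) ({()} : Finset Unit) (corner ℝ ({()} : Finset Unit))) φ
            * source (src (fun _ : Unit => ()) (0 : Unit → ℝ) ({()} : Finset Unit)) φ)
      (fun OX => (1 : ℝ) * ((max 1 (max 1 cg
              * (max 1 (phi0 (fun _ : Fin 0 => ([] : List ({x : Unit // (fun _ : Unit => ()) x ∈ ({()} : Finset Unit)} → ℝ)))
                (fun _ : Unit => [fun _ => (1 : ℝ)]) 1 OX.1 : ℝ)) ^ cg))
            ^ phi0 (fun _ : Fin 0 => ([] : List ({x : Unit // (fun _ : Unit => ()) x ∈ ({()} : Finset Unit)} → ℝ)))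
                (fun _ : Unit => [fun _ => (1 : ℝ)]) 1 OX.1
          * ∑ N ∈ range (phi0 (fun _ : Fin 0 => ([] : List ({x : Unit // (fun _ : Unit => ()) x ∈ ({()} : Finset Unit)} → ℝ)))
                (fun _ : Unit => [fun _ => (1 : ℝ)]) 1 OX.1 + 1),
            2 ^ N * ((0 : ℝ) ^ N + (1 + (max ((fun _ => (1 : ℝ)) ⬝ᵥ
              ((prec (fun _ : Unit => ()) (1 : Matrix Unit Unit ℝ) ({()} : Finset Unit) (corner ℝ ({()} : Finset Unit)))⁻¹
                *ᵥ fun _ => (1 : ℝ))) 0) ^ N * ((2 * N - 1).doubleFactorial : ℝ))))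
        * (max 1 (0 * ((phi0 (fun _ : Fin 0 => ([] : List ({x : Unit // (fun _ : Unit => ()) x ∈ ({()} : Finset Unit)} → ℝ)))
            (fun _ : Unit => [fun _ => (1 : ℝ)]) 1 OX.1 + 0 : ℕ) : ℝ)))
          ^ phi0 (fun _ : Fin 0 => ([] : List ({x : Unit // (fun _ : Unit => ()) x ∈ ({()} : Finset Unit)} → ℝ)))
            (fun _ : Unit => [fun _ => (1 : ℝ)]) 1 OX.1)
      (fun OX => ∏ _j ∈ OX.1.filter (fun j => j ∈ ({()} : Finset Unit)),
        (1 : ℝ) ^ ([fun _ : {x : Unit // (fun _ : Unit => ()) x ∈ ({()} : Finset Unit)} => (1 : ℝ)]).length)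
      (fun OX => nfreeOf (fun _ : Unit => (∅ : Finset Unit)) OX.2) 1 1 := by
  have hsrc : src (fun _ : Unit => ()) (0 : Unit → ℝ) ({()} : Finset Unit) = 0 := by funext x; simp [src]
  have hV : ∀ φ : {x : Unit // (fun _ : Unit => ()) x ∈ ({()} : Finset Unit)} → ℝ,
      |vexp (fun _ : Fin 0 => (0 : ℝ)) (fun _ : Fin 0 => []) φ| ≤ 1 := fun φ => by simp [vexp, vpoly]
  refine ineq312_remainder_bdry_prodCutoff_N (β := Unit) (Dir := Set.univ) (B' := fun _ => 0) (ρ := fun _ => 0)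
    (cV := fun _ => 0) toy_prec_posDef univ _ χp.smooth hgc hV le_rfl le_rfl
    (le_max_right _ _) (fun _ w hw => ?_) (fun m => m.elim0) one_pos le_rfl le_rfl (fun _ => le_rfl) (fun _ => le_rfl)
    (fun m => m.elim0) one_pos le_rfl one_pos le_rfl (fun _ u _ w _ => by simp) (fun _ u _ => by simp)
    (fun _ u _ => by simp) (fun m => m.elim0) (fun _ _ _ => Set.mem_univ _) (fun m => m.elim0)
    (fun _ _ => ⟨zero_le_one, rfl⟩) (fun _ h => absurd h Bool.false_ne_true) (fun m => m.elim0) le_rfl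
    (fun u _ => by simp) (fun _ u _ => by simp) ({()} : Finset Unit) (fun O t _ _ X _ => by simp)
  rw [List.mem_singleton] at hw; subst hw
  rw [hsrc, Matrix.mulVec_zero, dotProduct_zero, abs_zero]
  exact ⟨le_rfl, le_max_left _ _⟩

end Toy

end Literature.MathematicalPhysics.QuantumFieldTheory.BalabanImbrieJaffe1984to88.BIJ88WalkIneq312CovSplitVolFree

end
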